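import Mathlib
import Literature.Computability.AlgebraicComplexity.PermanentIrreducible

/-!
# `SmallCaseThreeFive` (stmt-ValiantsHypothesis-5644), line `Sketch` — stub `stub_defect_coeff`

Bookkeeping for the transfer layer of the degree-`55` Nullstellensatz refutation of Rep(3,5):
the `x`-coefficients of a defect polynomial `p - per₃` over the coefficient ring
`S = ℂ[250 unknowns]`.  Since `per₃ = ∑_ρ x^{μ_ρ}` with all coefficients `1`
(`perPoly_eq_sum_monomial`) and `ρ ↦ μ_ρ` is injective (`permMonomial_injective`), the coefficient
of `x^μ` in `map C per₃` is `1` if `μ` is a permutation pattern and `0` otherwise.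
-/

noncomputable section
set_option linter.dupNamespace false

namespace Summit.ValiantsHypothesis.ValiantsHypothesis.Theorems.RefutationDegreeSmallCaseThreeFive

open Literature.Computability.AlgebraicComplexity MvPolynomial
open scoped BigOperators

/-- The coefficients of a defect `p - per₃`: `(p - per₃).coeff μ = p.coeff μ - [μ is a
permutation pattern]` (`per₃ = Σ_ρ x^{μ_ρ}`, `perPoly_eq_sum_monomial`, `permMonomial_injective`). -/
theorem stub_defect_coeff
    (p : MvPolynomial (Fin 3 × Fin 3) (MvPolynomial (Option (Fin 3 × Fin 3) × (Fin 5 × Fin 5)) ℂ))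
    (μ : Fin 3 × Fin 3 →₀ ℕ) :
    (p - map C (perPoly (Fin 3) ℂ)).coeff μ =
      p.coeff μ - if μ ∈ Set.range (permMonomial (n := Fin 3)) then 1 else 0 := by
  rw [coeff_sub, coeff_map]
  congr 1
  split_ifs with h
  · obtain ⟨ρ, rfl⟩ := h
    rw [coeff_permMonomial_perPoly, map_one]
  · have h0 : coeff μ (perPoly (Fin 3) ℂ) = 0 := by
      by_contra hne
      exact h (exists_permMonomial_eq_of_coeff_perPoly_ne_zero ℂ hne)
    rw [h0, map_zero]

end Summit.ValiantsHypothesis.ValiantsHypothesis.Theorems.RefutationDegreeSmallCaseThreeFive
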